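import Summits.CriticalPhenomena.PercolationContinuityZ3.Theorems.PercNearOneGluingAdditiveGluingFibreSplice
import HarnessLib

/-!
# Crux `PercNearOneGluing.AdditiveGluing` (stmt-CriticalPhenomena-4576), line `tieline`:
# the kernel (T) REDUCES TO CONTRACTION-MONOTONICITY of its fibre counts at the boundary of `v`'s contracted component

Support file (`--supports stmt-CriticalPhenomena-4576`, helper, seat (d) exchange-certificate form).  No named facts,
no sorries, no definitions.

`covTransferQ_of_fibres` (file `…FibreCriterion`) reduces the registered kernel `stub_k0CovTransferQ_c9` ((T), roles `o b u v c`) to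
the nonnegativity of the weight-free fibre counts `fibreSumT o b u v c I`, `I : Sym2 (Fin n) → ℕ` the count vector (`I e = 3`:
`e` open in all three replicas, "contracted"; `I e = 0`: closed in all, "deleted"; `I e ∈ {1,2}`: the genuinely random edges of
the fibre).  Census finding of this seat (EXCHCERT-g7 §3, lab/cm3f.py + kit j066200; 2-replica analogue lab/chalf.py): for every
edge `e = s(x, z)` with `x` in the `I = 3`-component `V₃(v)` of `v`, `z` outside `V₃(v) ∪ V₃(u)` and `I e ∈ {1, 2}`,

  (CM3)   `fibreSumT o b u v c (I[e ↦ 3]) ≤ fibreSumT o b u v c I`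

("contracting a random edge at `v` can only decrease the signed count"; 0 violations on all u- and v-edges tested).  THIS FILE PROVES
THE REDUCTION (`fibreSumT_nonneg_of_contractionMonotone`): if (CM3) holds for the roles `o b u v c` at every count vector, then
every fibre count is `≥ 0` — hence, with `covTransferQ_of_fibres`, (T) at these roles for every weight vector
(`covTransferQ_of_contractionMonotone`).  Induction on the number of random edges: either a boundary edge of `V₃(v)` as in (CM3)
exists (contract it), or every random edge touching `V₃(v)` leads into `V₃(u)`; in the latter case, on the support of the summand
(`u ↮ v` in replicas 2 and 3) the clusters of `v` in replicas 2 and 3 both equal `V₃(v)`, so the global swap of replicas 2 ↔ 3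
negates the summand and the count is `0` (`fibreSumT_eq_zero_of_closed`).
[folklore] (induction on a finite measure; sign-reversing involution)
-/

namespace Summit.CriticalPhenomena.PercolationContinuityZ3.Cruxes.AdditiveGluing.TieLine.FibreCount

open MeasureTheory Set Finset Literature.Probability.Percolation
open Literature.Probability.LatticeModels (prodBernoulli)

open Classical

section Contraction

variable {n : ℕ}

/-- `cnt3 x y z = 3` iff all three Booleans are `true`. [folklore] -/
theorem cnt3_eq_three_iff (x y z : Bool) : cnt3 x y z = 3 ↔ x = true ∧ y = true ∧ z = true := by
  cases x <;> cases y <;> cases z <;> simp [cnt3]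

/-- `cnt3 x y z = 0` iff all three Booleans are `false`. [folklore] -/
theorem cnt3_eq_zero_iff (x y z : Bool) : cnt3 x y z = 0 ↔ x = false ∧ y = false ∧ z = false := by
  cases x <;> cases y <;> cases z <;> simp [cnt3]

/-- On the fibre of `I`, an edge with `I e = 3` is open in every replica. [folklore] -/
theorem open_of_cnt_eq_three {I : Sym2 (Fin n) → ℕ} {t : Triple (Sym2 (Fin n))} (ht : cnt t = I) {e : Sym2 (Fin n)}
    (he : I e = 3) : e ∈ cfg t.1 ∧ e ∈ cfg t.2.1 ∧ e ∈ cfg t.2.2 := by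
  have h3 : cnt t e = 3 := by rw [ht, he]
  unfold cnt at h3
  simpa only [cfg, Set.mem_setOf_eq] using (cnt3_eq_three_iff _ _ _).1 h3

/-- On the fibre of `I`, an edge open in some replica has `I e ≠ 0`. [folklore] -/
theorem cnt_ne_zero_of_open {I : Sym2 (Fin n) → ℕ} {t : Triple (Sym2 (Fin n))} (ht : cnt t = I) {e : Sym2 (Fin n)}
    (he : e ∈ cfg t.1 ∨ e ∈ cfg t.2.1 ∨ e ∈ cfg t.2.2) : I e ≠ 0 := by
  intro h0
  have h0' : cnt t e = 0 := by rw [ht, h0]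
  unfold cnt at h0'
  obtain ⟨h1, h2, h3⟩ := (cnt3_eq_zero_iff _ _ _).1 h0'
  simp only [cfg, Set.mem_setOf_eq, h1, h2, h3] at he
  simp at he

/-- The `3`-edges of a count vector, as a configuration. [folklore] -/
theorem mem_threeSet_iff (I : Sym2 (Fin n) → ℕ) (e : Sym2 (Fin n)) : e ∈ {e : Sym2 (Fin n) | I e = 3} ↔ I e = 3 := Iff.rfl

/-- If an `I = 3`-edge is open in `ω`, the `3`-component of `v` is reached inside `ω`. [folklore] -/
theorem reach_of_reach_three {I : Sym2 (Fin n) → ℕ} {ω : Set (Sym2 (Fin n))} (hω : {e | I e = 3} ⊆ ω) {v x : Fin n}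
    (h : (openGraph {e | I e = 3}).Reachable v x) : (openGraph ω).Reachable v x :=
  h.mono (BHK2006.openGraph_le hω)

/-- **The closed case.**  If every edge `e` touching the `3`-component `V₃(v)` of `v` with `I e ≠ 0, 3` has its other endpoint in
the `3`-component of `u`, then for a configuration `ω ⊇ {I = 3}` all of whose edges have `I ≠ 0` and in which `u ↮ v`, the open
cluster of `v` is exactly `V₃(v)`. [folklore] -/
theorem reach_iff_three_of_closed {I : Sym2 (Fin n) → ℕ} {u v : Fin n}
    (hcl : ∀ x z : Fin n, (openGraph {e | I e = 3}).Reachable v x → ¬ (openGraph {e | I e = 3}).Reachable v z →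
      I s(x, z) ≠ 0 → (openGraph {e | I e = 3}).Reachable u z)
    {ω : Set (Sym2 (Fin n))} (h3 : {e | I e = 3} ⊆ ω) (h0 : ∀ e ∈ ω, I e ≠ 0) (hD : ¬ (openGraph ω).Reachable u v) (x : Fin n) :
    (openGraph ω).Reachable v x ↔ (openGraph {e | I e = 3}).Reachable v x := by
  refine ⟨fun h => ?_, reach_of_reach_three h3⟩
  rw [SimpleGraph.reachable_iff_reflTransGen] at h
  induction h with
  | refl => exact SimpleGraph.Reachable.refl v
  | @tail y z _ hyz ih =>
    by_contra hz
    rw [openGraph_adj] at hyz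
    have hne : I s(y, z) ≠ 0 := h0 _ hyz.1
    have huz := hcl y z ih hz hne
    -- then `u ↔ z ↔ y ↔ v` in `ω`
    apply hD
    have hzy : (openGraph ω).Adj z y := by
      rw [openGraph_adj]; exact ⟨by rw [Sym2.eq_swap]; exact hyz.1, hyz.2.symm⟩
    exact ((reach_of_reach_three h3 huz).trans hzy.reachable).trans (reach_of_reach_three h3 ih).symm

/-- **Base case: the count vanishes when `V₃(v)` is closed.**  If every edge touching `V₃(v)` with `I ≠ 0, 3` leads into `V₃(u)`,
then `fibreSumT o b u v c I = 0`: on the support (`u ↮ v` in replicas 2, 3) the clusters of `v` in replicas 2 and 3 coincide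
with `V₃(v)`, and the global swap of replicas `2 ↔ 3` negates the summand. [folklore] -/
theorem fibreSumT_eq_zero_of_closed (o b u v c : Fin n) (I : Sym2 (Fin n) → ℕ)
    (hcl : ∀ x z : Fin n, (openGraph {e | I e = 3}).Reachable v x → ¬ (openGraph {e | I e = 3}).Reachable v z →
      I s(x, z) ≠ 0 → (openGraph {e | I e = 3}).Reachable u z) :
    fibreSumT o b u v c I = 0 := by
  unfold fibreSumT
  refine fibreSum4_eq_zero_of_involution (fun t => (t.1, t.2.2, t.2.1)) (fun t => rfl)
    (fun t => by funext i; simp only [cnt, cnt3]; omega) 1 (-1) (-1) 1 _ _ _ _ _ _ _ _ _ _ _ _ I ?_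
  intro t ht hne
  -- the three replicas contain the 3-edges and avoid the 0-edges
  have h3 : ∀ k : Set (Sym2 (Fin n)), (k = cfg t.1 ∨ k = cfg t.2.1 ∨ k = cfg t.2.2) → {e | I e = 3} ⊆ k := by
    rintro k hk e he
    obtain ⟨h1, h2, h3⟩ := open_of_cnt_eq_three ht he
    rcases hk with rfl | rfl | rfl
    · exact h1
    · exact h2
    · exact h3
  have h0₂ : ∀ e ∈ cfg t.2.1, I e ≠ 0 := fun e he => cnt_ne_zero_of_open ht (Or.inr (Or.inl he))
  have h0₃ : ∀ e ∈ cfg t.2.2, I e ≠ 0 := fun e he => cnt_ne_zero_of_open ht (Or.inr (Or.inr he))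
  simp only [ind, Set.mem_inter_iff, Set.mem_compl_iff, openConn, Set.mem_setOf_eq] at hne ⊢
  -- standing constraints
  have hD₂ : ¬ (openGraph (cfg t.2.1)).Reachable u v := by
    by_contra hD; apply hne; simp [hD]
  have hD₃ : ¬ (openGraph (cfg t.2.2)).Reachable u v := by
    by_contra hD; apply hne; simp [hD]
  -- `v`'s clusters in replicas 2 and 3 agree (both are `V₃(v)`)
  have hv : ∀ x, (openGraph (cfg t.2.2)).Reachable v x ↔ (openGraph (cfg t.2.1)).Reachable v x := fun x =>
    (reach_iff_three_of_closed hcl (h3 _ (Or.inr (Or.inr rfl))) h0₃ hD₃ x).trans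
      (reach_iff_three_of_closed hcl (h3 _ (Or.inr (Or.inl rfl))) h0₂ hD₂ x).symm
  simp only [hD₂, hD₃, hv, not_false_eq_true, true_and] at hne ⊢
  -- the remaining atoms: the summand is antisymmetric in (ub₂, ub₃)
  generalize (openGraph (cfg t.1)).Reachable c u = Ncu at hne ⊢
  generalize (openGraph (cfg t.1)).Reachable c v = Ncv at hne ⊢
  generalize (openGraph (cfg t.1)).Reachable o c = OC at hne ⊢
  generalize (openGraph (cfg t.2.1)).Reachable u b = UB₂ at hne ⊢
  generalize (openGraph (cfg t.2.2)).Reachable u b = UB₃ at hne ⊢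
  generalize (openGraph (cfg t.2.1)).Reachable v o = VO at hne ⊢
  generalize (openGraph (cfg t.2.1)).Reachable v c = VC at hne ⊢
  by_cases h1 : Ncu <;> by_cases h2 : Ncv <;> by_cases h3' : OC <;> by_cases h4 : UB₂ <;> by_cases h5 : UB₃ <;>
    by_cases h6 : VO <;> by_cases h7 : VC <;> simp [h1, h2, h3', h4, h5, h6, h7] at hne ⊢

/-- A count vector with a value above `3` has an empty fibre, so its count vanishes. [folklore] -/
theorem fibreSumT_eq_zero_of_three_lt (o b u v c : Fin n) (I : Sym2 (Fin n) → ℕ) {e : Sym2 (Fin n)} (he : 3 < I e) :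
    fibreSumT o b u v c I = 0 := by
  unfold fibreSumT fibreSum4
  refine Finset.sum_eq_zero fun t ht => ?_
  exfalso
  have hI := (Finset.mem_filter.1 ht).2
  have : cnt t e ≤ 3 := by
    unfold cnt cnt3
    cases t.1 e <;> cases t.2.1 e <;> cases t.2.2 e <;> simp
  rw [hI] at this
  omega

/-- The number of random (`I ∈ {1,2}`) edges of a count vector. [folklore] -/
theorem card_random_lt_of_update {I : Sym2 (Fin n) → ℕ} {e : Sym2 (Fin n)} (he : I e = 1 ∨ I e = 2) :
    ((Finset.univ : Finset (Sym2 (Fin n))).filter (fun f => Function.update I e 3 f = 1 ∨ Function.update I e 3 f = 2)).card <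
      ((Finset.univ : Finset (Sym2 (Fin n))).filter (fun f => I f = 1 ∨ I f = 2)).card := by
  apply Finset.card_lt_card
  rw [Finset.ssubset_iff_of_subset]
  · refine ⟨e, Finset.mem_filter.2 ⟨Finset.mem_univ _, he⟩, ?_⟩
    simp only [Finset.mem_filter, Finset.mem_univ, true_and, Function.update_self]
    omega
  · intro f hf
    simp only [Finset.mem_filter, Finset.mem_univ, true_and] at hf ⊢
    by_cases hfe : f = e
    · rw [hfe, Function.update_self] at hf; omega
    · rwa [Function.update_of_ne hfe] at hf

/-- **(T)'s fibre counts from contraction-monotonicity.**  Suppose that for every count vector `I` and every edge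
`e = s(x, z)` with `x` in the `3`-component of `v`, `z` outside the `3`-components of `v` and of `u`, and `I e ∈ {1, 2}`, contracting
`e` does not increase the count: `fibreSumT o b u v c (I[e ↦ 3]) ≤ fibreSumT o b u v c I` (hypothesis (CM3)).  Then every fibre
count of (T) at the roles `o b u v c` is nonnegative. [folklore] -/
theorem fibreSumT_nonneg_of_contractionMonotone (o b u v c : Fin n)
    (hCM : ∀ I : Sym2 (Fin n) → ℕ, ∀ x z : Fin n, (openGraph {e | I e = 3}).Reachable v x →
      ¬ (openGraph {e | I e = 3}).Reachable v z → ¬ (openGraph {e | I e = 3}).Reachable u z →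
      (I s(x, z) = 1 ∨ I s(x, z) = 2) →
      fibreSumT o b u v c (Function.update I s(x, z) 3) ≤ fibreSumT o b u v c I)
    (I : Sym2 (Fin n) → ℕ) : 0 ≤ fibreSumT o b u v c I := by
  -- induction on the number of random edges
  generalize hm : ((Finset.univ : Finset (Sym2 (Fin n))).filter (fun f => I f = 1 ∨ I f = 2)).card = m
  induction m using Nat.strong_induction_on generalizing I with
  | _ m ih =>
    by_cases hex : ∃ x z : Fin n, (openGraph {e | I e = 3}).Reachable v x ∧ ¬ (openGraph {e | I e = 3}).Reachable v z ∧
        ¬ (openGraph {e | I e = 3}).Reachable u z ∧ (I s(x, z) = 1 ∨ I s(x, z) = 2)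
    · obtain ⟨x, z, hx, hz, huz, he⟩ := hex
      refine le_trans ?_ (hCM I x z hx hz huz he)
      exact ih _ (hm ▸ card_random_lt_of_update he) _ rfl
    · -- degenerate count vectors (a value above 3) have empty fibres
      by_cases hbig : ∃ e, 3 < I e
      · obtain ⟨e, he⟩ := hbig
        exact (fibreSumT_eq_zero_of_three_lt o b u v c I he).symm.le
      -- closed case: the count vanishes
      refine (fibreSumT_eq_zero_of_closed o b u v c I fun x z hx hz hne => ?_).symm.le
      by_contra huz
      apply hex
      refine ⟨x, z, hx, hz, huz, ?_⟩
      have hne3 : I s(x, z) ≠ 3 := by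
        intro h3
        apply hz
        by_cases hxz : x = z
        · rw [← hxz]; exact hx
        · refine hx.trans (SimpleGraph.Adj.reachable ?_)
          rw [openGraph_adj]; exact ⟨h3, hxz⟩
      have hle : I s(x, z) ≤ 3 := by
        by_contra hgt
        exact hbig ⟨s(x, z), by omega⟩
      omega

/-- **The kernel (T) from contraction-monotonicity.**  If (CM3) holds at the roles `o b u v c` for every count vector, the
registered covariance-transfer inequality (T) = `stub_k0CovTransferQ_c9` holds at `(n, w, o, b, u, v, c)` for EVERY weight vector
`w` (`covTransferQ_of_fibres` + `fibreSumT_nonneg_of_contractionMonotone`). [folklore] -/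
theorem covTransferQ_of_contractionMonotone (w : Sym2 (Fin n) → unitInterval) (o b u v c : Fin n)
    (hCM : ∀ I : Sym2 (Fin n) → ℕ, ∀ x z : Fin n, (openGraph {e | I e = 3}).Reachable v x →
      ¬ (openGraph {e | I e = 3}).Reachable v z → ¬ (openGraph {e | I e = 3}).Reachable u z →
      (I s(x, z) = 1 ∨ I s(x, z) = 2) →
      fibreSumT o b u v c (Function.update I s(x, z) 3) ≤ fibreSumT o b u v c I) :
    (prodBernoulli w).real ((openConn u v)ᶜ : Set (BondConfig (Fin n))) *
        ((prodBernoulli w).real ((openConn u v)ᶜ ∩ openConn u b ∩ openConn v o : Set (BondConfig (Fin n))) *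
            (prodBernoulli w).real ((openConn c u)ᶜ ∩ (openConn c v)ᶜ : Set (BondConfig (Fin n))) -
          (prodBernoulli w).real ((openConn u v)ᶜ ∩ openConn u b ∩ openConn v c : Set (BondConfig (Fin n))) *
            (prodBernoulli w).real ((openConn c u)ᶜ ∩ (openConn c v)ᶜ ∩ openConn o c : Set (BondConfig (Fin n)))) ≤
      (prodBernoulli w).real ((openConn u v)ᶜ ∩ openConn u b : Set (BondConfig (Fin n))) *
        ((prodBernoulli w).real ((openConn u v)ᶜ ∩ openConn v o : Set (BondConfig (Fin n))) *
            (prodBernoulli w).real ((openConn c u)ᶜ ∩ (openConn c v)ᶜ : Set (BondConfig (Fin n))) -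
          (prodBernoulli w).real ((openConn u v)ᶜ ∩ openConn v c : Set (BondConfig (Fin n))) *
            (prodBernoulli w).real ((openConn c u)ᶜ ∩ (openConn c v)ᶜ ∩ openConn o c : Set (BondConfig (Fin n)))) :=
  covTransferQ_of_fibres w o b u v c (fibreSumT_nonneg_of_contractionMonotone o b u v c hCM)

/-! ### The u-side variant: contracting random edges at the boundary of `u`'s 3-component

Census (lab/cm3f.py): (CM3) also holds at every edge incident to `u` (not joining `u` to `v`).  The corresponding reduction has a
POINTWISE base case: if every random edge touching `V₃(u)` leads into `V₃(v)`, then on the support (`u ↮ v` in replicas 2, 3) the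
clusters of `u` in replicas 2 and 3 both equal `V₃(u)`, so `ub₂ = ub₃` and every summand vanishes. -/

/-- **Base case (u-side).**  If every edge touching `V₃(u)` with `I ≠ 0, 3` leads into `V₃(v)`, then `fibreSumT o b u v c I = 0`
(every summand vanishes: `u ↔ b` agrees in replicas 2 and 3). [folklore] -/
theorem fibreSumT_eq_zero_of_closed_u (o b u v c : Fin n) (I : Sym2 (Fin n) → ℕ)
    (hcl : ∀ x z : Fin n, (openGraph {e | I e = 3}).Reachable u x → ¬ (openGraph {e | I e = 3}).Reachable u z →
      I s(x, z) ≠ 0 → (openGraph {e | I e = 3}).Reachable v z) :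
    fibreSumT o b u v c I = 0 := by
  unfold fibreSumT fibreSum4
  refine Finset.sum_eq_zero fun t ht => ?_
  have ht' : cnt t = I := (Finset.mem_filter.1 ht).2
  have h3₂ : {e | I e = 3} ⊆ cfg t.2.1 := fun e he => (open_of_cnt_eq_three ht' he).2.1
  have h3₃ : {e | I e = 3} ⊆ cfg t.2.2 := fun e he => (open_of_cnt_eq_three ht' he).2.2
  have h0₂ : ∀ e ∈ cfg t.2.1, I e ≠ 0 := fun e he => cnt_ne_zero_of_open ht' (Or.inr (Or.inl he))
  have h0₃ : ∀ e ∈ cfg t.2.2, I e ≠ 0 := fun e he => cnt_ne_zero_of_open ht' (Or.inr (Or.inr he))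
  simp only [ind, Set.mem_inter_iff, Set.mem_compl_iff, openConn, Set.mem_setOf_eq]
  by_cases hD₂ : (openGraph (cfg t.2.1)).Reachable u v
  · simp [hD₂]
  by_cases hD₃ : (openGraph (cfg t.2.2)).Reachable u v
  · simp [hD₃]
  -- `u`'s clusters in replicas 2 and 3 agree (both are `V₃(u)`); the roles of `u, v` in `reach_iff_three_of_closed` are swapped
  have hu₂ : ∀ x, (openGraph (cfg t.2.1)).Reachable u x ↔ (openGraph {e | I e = 3}).Reachable u x := fun x =>
    reach_iff_three_of_closed (u := v) (v := u) hcl h3₂ h0₂ (fun h => hD₂ h.symm) x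
  have hu₃ : ∀ x, (openGraph (cfg t.2.2)).Reachable u x ↔ (openGraph {e | I e = 3}).Reachable u x := fun x =>
    reach_iff_three_of_closed (u := v) (v := u) hcl h3₃ h0₃ (fun h => hD₃ h.symm) x
  have hub : (openGraph (cfg t.2.2)).Reachable u b ↔ (openGraph (cfg t.2.1)).Reachable u b := (hu₃ b).trans (hu₂ b).symm
  simp only [hD₂, hD₃, hub, not_false_eq_true, true_and]
  generalize (openGraph (cfg t.1)).Reachable c u = Ncu
  generalize (openGraph (cfg t.1)).Reachable c v = Ncv
  generalize (openGraph (cfg t.1)).Reachable o c = OC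
  generalize (openGraph (cfg t.2.1)).Reachable u b = UB
  generalize (openGraph (cfg t.2.2)).Reachable v o = VO
  generalize (openGraph (cfg t.2.2)).Reachable v c = VC
  by_cases h1 : Ncu <;> by_cases h2 : Ncv <;> by_cases h3' : OC <;> by_cases h4 : UB <;> by_cases h6 : VO <;>
    by_cases h7 : VC <;> simp [h1, h2, h3', h4, h6, h7]

/-- **(T)'s fibre counts from contraction-monotonicity at `u`.**  Suppose that for every count vector `I` and every edge
`e = s(x, z)` with `x` in the `3`-component of `u`, `z` outside the `3`-components of `u` and of `v`, and `I e ∈ {1, 2}`, contracting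
`e` does not increase the count.  Then every fibre count of (T) at the roles `o b u v c` is nonnegative. [folklore] -/
theorem fibreSumT_nonneg_of_contractionMonotone_u (o b u v c : Fin n)
    (hCM : ∀ I : Sym2 (Fin n) → ℕ, ∀ x z : Fin n, (openGraph {e | I e = 3}).Reachable u x →
      ¬ (openGraph {e | I e = 3}).Reachable u z → ¬ (openGraph {e | I e = 3}).Reachable v z →
      (I s(x, z) = 1 ∨ I s(x, z) = 2) →
      fibreSumT o b u v c (Function.update I s(x, z) 3) ≤ fibreSumT o b u v c I)
    (I : Sym2 (Fin n) → ℕ) : 0 ≤ fibreSumT o b u v c I := by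
  generalize hm : ((Finset.univ : Finset (Sym2 (Fin n))).filter (fun f => I f = 1 ∨ I f = 2)).card = m
  induction m using Nat.strong_induction_on generalizing I with
  | _ m ih =>
    by_cases hex : ∃ x z : Fin n, (openGraph {e | I e = 3}).Reachable u x ∧ ¬ (openGraph {e | I e = 3}).Reachable u z ∧
        ¬ (openGraph {e | I e = 3}).Reachable v z ∧ (I s(x, z) = 1 ∨ I s(x, z) = 2)
    · obtain ⟨x, z, hx, hz, hvz, he⟩ := hex
      refine le_trans ?_ (hCM I x z hx hz hvz he)
      exact ih _ (hm ▸ card_random_lt_of_update he) _ rfl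
    · by_cases hbig : ∃ e, 3 < I e
      · obtain ⟨e, he⟩ := hbig
        exact (fibreSumT_eq_zero_of_three_lt o b u v c I he).symm.le
      refine (fibreSumT_eq_zero_of_closed_u o b u v c I fun x z hx hz hne => ?_).symm.le
      by_contra hvz
      apply hex
      refine ⟨x, z, hx, hz, hvz, ?_⟩
      have hne3 : I s(x, z) ≠ 3 := by
        intro h3
        apply hz
        by_cases hxz : x = z
        · rw [← hxz]; exact hx
        · refine hx.trans (SimpleGraph.Adj.reachable ?_)
          rw [openGraph_adj]; exact ⟨h3, hxz⟩
      have hle : I s(x, z) ≤ 3 := by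
        by_contra hgt
        exact hbig ⟨s(x, z), by omega⟩
      omega

/-- **The kernel (T) from contraction-monotonicity at `u`.** [folklore] -/
theorem covTransferQ_of_contractionMonotone_u (w : Sym2 (Fin n) → unitInterval) (o b u v c : Fin n)
    (hCM : ∀ I : Sym2 (Fin n) → ℕ, ∀ x z : Fin n, (openGraph {e | I e = 3}).Reachable u x →
      ¬ (openGraph {e | I e = 3}).Reachable u z → ¬ (openGraph {e | I e = 3}).Reachable v z →
      (I s(x, z) = 1 ∨ I s(x, z) = 2) →
      fibreSumT o b u v c (Function.update I s(x, z) 3) ≤ fibreSumT o b u v c I) :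
    (prodBernoulli w).real ((openConn u v)ᶜ : Set (BondConfig (Fin n))) *
        ((prodBernoulli w).real ((openConn u v)ᶜ ∩ openConn u b ∩ openConn v o : Set (BondConfig (Fin n))) *
            (prodBernoulli w).real ((openConn c u)ᶜ ∩ (openConn c v)ᶜ : Set (BondConfig (Fin n))) -
          (prodBernoulli w).real ((openConn u v)ᶜ ∩ openConn u b ∩ openConn v c : Set (BondConfig (Fin n))) *
            (prodBernoulli w).real ((openConn c u)ᶜ ∩ (openConn c v)ᶜ ∩ openConn o c : Set (BondConfig (Fin n)))) ≤
      (prodBernoulli w).real ((openConn u v)ᶜ ∩ openConn u b : Set (BondConfig (Fin n))) *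
        ((prodBernoulli w).real ((openConn u v)ᶜ ∩ openConn v o : Set (BondConfig (Fin n))) *
            (prodBernoulli w).real ((openConn c u)ᶜ ∩ (openConn c v)ᶜ : Set (BondConfig (Fin n))) -
          (prodBernoulli w).real ((openConn u v)ᶜ ∩ openConn v c : Set (BondConfig (Fin n))) *
            (prodBernoulli w).real ((openConn c u)ᶜ ∩ (openConn c v)ᶜ ∩ openConn o c : Set (BondConfig (Fin n)))) :=
  covTransferQ_of_fibres w o b u v c (fibreSumT_nonneg_of_contractionMonotone_u o b u v c hCM)

end Contraction

end Summit.CriticalPhenomena.PercolationContinuityZ3.Cruxes.AdditiveGluing.TieLine.FibreCount
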